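import Literature.NumberTheory.LFunctions.Zhang2022.DetectorDictForm
import Literature.NumberTheory.LFunctions.Zhang2022.DetectorTwoSidedArcs
import Literature.NumberTheory.LFunctions.Zhang2022.DetectorDoublingCompose

/-!
# The shift dictionary «dict_S» on an ARBITRARY profile is `c₀` times the bulk energy on the circle ℝ/2ℤ
# (Id-6/Id-7 kernel leaf: the closed form [K1‴] and the assembly in interface form)

Sub-cell E of the `landau-siegel` programme (E*-S(i) two-sided WITH OVERLAP; booking ls-barrier-plan g1
2026-08-27T03:23:31Z «the overlap part needs the full-circle Id-7 leaf (pen TBD)»; CLAIM ls-barrier-num g3 03:39:10Z).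
Identities of record (numerics custodians, exact): ls-num-2 g4 «Id-6» 02:37:15Z (printed triple, every `C¹` profile; ledger
l.7400 with ls-num-1 j266169) and «Id-7» 02:56:33Z (general triple: lineage A's windowed closed form `(4.1)_S` = the tree's
`Det.DictShift` ≡ the circle energy; kit j266432, ledger l.7403); ls-barrier-num g3 kit j266465 (symbolic-`π` zero at
`(1,2,3)`) and this file's float check `id7_check.py` (24/24 to 1e-15).

THE STATEMENT. For a profile `G` on `[0,1]` (NO apex condition: `a₁ = G(1⁻)` free — the glued two-sided profile
`g₁ + R̃g₂` of ANY overlap geometry is such a `G`), with `S_G = tailPrim G`, `I = ∫₀¹G`, `a₀ = G(0)`: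

* Part 1 — **[K1‴] `Det.dictShift_eq_bulk_add_twoPoint`**:
  `(π/2)·DictShift b G = c₀·T_b^([0,1])(S_G) + F_b(I, −a₀) + F_b(0, −conj a₁) + π·Re F₀^(W′,c_g)(a₀, I; conj a₁, 0)`
  (`F_b = Det.freeEndForm b`, `F₀ = Det.F0DetC (shiftGlueW b) (shiftGlue0 b) b`): the three APEX terms of «dict_S» are
  exactly a second free-end form at the apex jet `(0, −conj a₁)` plus the formula-II glue block between the two end jets.
  Pure bookkeeping over `Det.bulkFormOn_tailPrim_eq_re_shiftCore` (K1), `Det.re_shiftCore_self`, `Det.F0DetC_expand` and the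
  two integrations by parts `2Re⟨G′,G⟩ = |a₁|² − |a₀|²`, `2Re⟨G,S_head⟩ = |I|²` (`DetectorDictForm`); `b` with non-zero
  entries (no distinctness needed).
* Part 2 — **ASSEMBLY, interface form** `Det.dictShift_nonneg_of_twoPointPieces`: GIVEN the two-point pieces of K2″
  (`∃ E` on `[0,1]` with jets `(−conj p₂, conj q₂) | (p₁, q₁)` and `c₀·T(E) = F_b(p₁,q₁) + F_b(p₂,q₂) + π·Re F₀(−q₁,p₁;−q₂,p₂)`
  — ls-barrier-num's `Det.twoPoint_pieces`, `DetectorTwoPointIdentity`, via ls-barrier-p5 g4's dictionary), for every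
  SIGN-ADMISSIBLE `b` and every one-sided-differentiable (kinked) profile `G`: **`0 ≤ DictShift b G G′`** — by Part 1 with
  `(p₁,q₁,p₂,q₂) = (I, −a₀, 0, −conj a₁)`, the PERIODIC two-piece Parseval inequality
  `Det.bulkFormOn_periodic_two_piece_nonneg_of_signAdmissible` (ls-barrier-p5 g4, `DetectorTwoSidedArcs`) on the pieces
  `E(·+1)` on `[−1,0]` and `S_G` on `[0,1]` (their jets match at `0` and periodically at `∓1` BY CONSTRUCTION), and
  `c₀ > 0` (`Det.re_sum_shiftW_pos`).

So, once K2″ is in the tree, «dict_S ⪰ 0 on kinked profiles» holds for EVERY sign-admissible triple and EVERY geometry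
(one-sided, two-sided without or WITH overlap) — the E*-S(i) slot of the family `Repair.familyDetGlued` (ls-barrier-p6 g3,
`RepairDetGlued`) on the kinked sub-class of its `H¹` profiles. Nothing here asserts that «dict_S» is the manuscript's
main term at general shifts (caveat of record: derivation-by-consistency; `= 𝔅 = C₂₃₂S` at `(1,2,3)`, `dictShift_std`).
0 facts, 0 sorries. «The programme SEARCHES and TYPES; no claim about Landau–Siegel zeros, Theorems 1–2 of arXiv:2211.02515
or a repaired Margin232 until a kernel theorem says so.» -/

noncomputable section

open Complex Real ComplexConjugate Set MeasureTheory intervalIntegral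

namespace Literature.NumberTheory.LFunctions.Zhang2022

namespace Det

open Repair

variable {b : Fin 3 → ℝ} {G G' : ℝ → ℂ}

/-! ### Part 1 — [K1‴] the shift dictionary as bulk + two free-end forms + glue -/

/-- `∫ conj = conj ∫` on `[a,b]`. [folklore] -/
private theorem conj_intervalIntegral_dc (f : ℝ → ℂ) (a c : ℝ) :
    conj (∫ x in a..c, f x) = ∫ x in a..c, conj (f x) := by
  simp only [intervalIntegral, map_sub, integral_conj]

/-- `⟨G, G′⟩ = conj ⟨G′, G⟩`. [folklore] -/
private theorem integral_mul_conj_swap_dc (g g' : ℝ → ℂ) :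
    (∫ x in (0:ℝ)..1, g x * conj (g' x)) = conj (∫ x in (0:ℝ)..1, g' x * conj (g x)) := by
  rw [conj_intervalIntegral_dc]
  refine intervalIntegral.integral_congr fun x _ => ?_
  simp [mul_comm]

/-- Pointwise algebra of [K1‴]: the identity in the seven profile scalars and the recipe scalars, all opaque, GIVEN the
two integration-by-parts relations. [folklore] -/
private theorem k1ppp_aux (W0 W1 W2 Wp cg A2 C4 I0 a0 a1 : ℂ) (b0 b1 b2 A1 A5 : ℝ)
    (hA2 : 2 * A2.re = (a1.re * a1.re + a1.im * a1.im) - (a0.re * a0.re + a0.im * a0.im))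
    (hC4 : 2 * C4.re = I0.re * I0.re + I0.im * I0.im) :
    π / 2 *
        (2 / π * (W0 + W1 + W2).re * A1
          + 2 * ((W0 * ((b1 + b2 : ℝ) : ℂ) + W1 * ((b2 + b0 : ℝ) : ℂ) + W2 * ((b0 + b1 : ℝ) : ℂ)) * A2).im
          - 2 * ((W0 * (b0 : ℂ) + W1 * (b1 : ℂ) + W2 * (b2 : ℂ)) * conj A2).im
          + 2 * π * ((W0 * ((b1 * b2 : ℝ) : ℂ) + W1 * ((b2 * b0 : ℝ) : ℂ) + W2 * ((b0 * b1 : ℝ) : ℂ))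
              + (W0 * ((b0 : ℂ) * ((b1 + b2 : ℝ) : ℂ)) + W1 * ((b1 : ℂ) * ((b2 + b0 : ℝ) : ℂ))
                + W2 * ((b2 : ℂ) * ((b0 + b1 : ℝ) : ℂ)))).re * A5
          - 2 * π * ((W0 * ((b1 * b2 : ℝ) : ℂ) + W1 * ((b2 * b0 : ℝ) : ℂ) + W2 * ((b0 * b1 : ℝ) : ℂ))
              * (a0 * conj I0)).re
          - 2 * π ^ 2 * ((W0 * ((b0 : ℂ) * ((b1 * b2 : ℝ) : ℂ)) + W1 * ((b1 : ℂ) * ((b2 * b0 : ℝ) : ℂ))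
              + W2 * ((b2 : ℂ) * ((b0 * b1 : ℝ) : ℂ))) * (I0 * conj I0 - C4)).im
          - 2 * π * (conj (W0 * ((b1 * b2 : ℝ) : ℂ) + W1 * ((b2 * b0 : ℝ) : ℂ) + W2 * ((b0 * b1 : ℝ) : ℂ))
              * a1 * conj I0).re
          + 2 * (-I * (Wp + cg) * a0 * conj a1).re
          + 2 * ((W0 * (b0 : ℂ) + W1 * (b1 : ℂ) + W2 * (b2 : ℂ))
              - (W0 * ((b1 + b2 : ℝ) : ℂ) + W1 * ((b2 + b0 : ℝ) : ℂ) + W2 * ((b0 + b1 : ℝ) : ℂ))).im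
              * (a1.re * a1.re + a1.im * a1.im))
      = (W0 + W1 + W2).re *
          (A1 - π * (b0 + b1 + b2) * (conj A2).im + π ^ 2 * (b0 * b1 + b0 * b2 + b1 * b2) * A5
            - π ^ 3 * (b0 * b1 * b2) * (I0 * conj I0 - C4).im)
        + (-((W0 + W1 + W2).im / 2) * (π ^ 3 * (b0 * b1 * b2) * (I0.re * I0.re + I0.im * I0.im)
              + π * (b0 + b1 + b2) * (a0.re * a0.re + a0.im * a0.im))
            + π * (W0 * (b0 : ℂ) + W1 * (b1 : ℂ) + W2 * (b2 : ℂ)).im * (a0.re * a0.re + a0.im * a0.im)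
            + π ^ 2 * ((W0 * ((b1 * b2 : ℝ) : ℂ) + W1 * ((b2 * b0 : ℝ) : ℂ) + W2 * ((b0 * b1 : ℝ) : ℂ))
                * (-a0) * conj I0).re)
        + (-((W0 + W1 + W2).im / 2) * (π ^ 3 * (b0 * b1 * b2) * (0:ℝ)
              + π * (b0 + b1 + b2) * (a1.re * a1.re + a1.im * a1.im))
            + π * (W0 * (b0 : ℂ) + W1 * (b1 : ℂ) + W2 * (b2 : ℂ)).im * (a1.re * a1.re + a1.im * a1.im)
            + π ^ 2 * ((W0 * ((b1 * b2 : ℝ) : ℂ) + W1 * ((b2 * b0 : ℝ) : ℂ) + W2 * ((b0 * b1 : ℝ) : ℂ))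
                * (-conj a1) * conj (0:ℂ)).re)
        + π * (-I * ((Wp + cg) * (a0 * conj a1))
              - π * (W0 * ((b1 * b2 : ℝ) : ℂ) + W1 * ((b2 * b0 : ℝ) : ℂ) + W2 * ((b0 * b1 : ℝ) : ℂ))
                  * (a0 * 0 + I0 * conj a1)
              + I * π ^ 2 * (W0 * ((b0 : ℂ) * ((b1 * b2 : ℝ) : ℂ)) + W1 * ((b1 : ℂ) * ((b2 * b0 : ℝ) : ℂ))
                  + W2 * ((b2 : ℂ) * ((b0 * b1 : ℝ) : ℂ))) * (I0 * 0)).re := by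
  simp only [Complex.add_re, Complex.sub_re, Complex.neg_re, Complex.mul_re, Complex.mul_im, Complex.add_im,
    Complex.sub_im, Complex.neg_im, Complex.conj_re, Complex.conj_im, Complex.I_re, Complex.I_im, Complex.ofReal_re,
    Complex.ofReal_im, Complex.zero_re, Complex.zero_im]
  have hπ : (π : ℝ) ≠ 0 := Real.pi_ne_zero
  have h1 : π / 2 * (2 / π * (W0.re + W1.re + W2.re) * A1) = (W0.re + W1.re + W2.re) * A1 := by
    field_simp
  linear_combination h1 + (π / 2 * ((b1 + b2 - b0) * W0.im + (b2 + b0 - b1) * W1.im + (b0 + b1 - b2) * W2.im)) * hA2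
    + (π ^ 3 * (b0 * b1 * b2) * (W0.im + W1.im + W2.im) / 2) * hC4

/-- **[K1‴] The shift dictionary as bulk + two free-end forms + glue.** For a real triple `b` with non-zero entries and a kinked profile `G` on `[0,1]` (apex `G(1)` FREE):
`(π/2)·DictShift b G = c₀·T_b^([0,1])(tailPrim G) + freeEndForm b (∫G) (−G 0) + freeEndForm b 0 (−conj (G 1))
 + π·Re F0DetC (shiftGlueW b) (shiftGlue0 b) b (G 0) (∫G) (conj (G 1)) 0` (non-zero entries `b_j`; NO distinctness
needed). For `G(1) = 0` the last two summands
vanish and this is K1 (`formDet_shiftRecipe_eq_bulk_add_freeEnd` with `dictShift_eq_formDet`).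
[cite: Zhang2022LandauSiegel, §4 (4.1); Prop 7.1 p.44 with (8.11)–(8.23); Prop 14.1; Lemma 15.1; §18 (18.1)] -/
theorem dictShift_eq_bulk_add_twoPoint (hb0 : ∀ j, b j ≠ 0) (hG : KinkedProfile G G') :
    π / 2 * DictShift b G G'
      = (∑ j : Fin 3, shiftW b j).re * bulkFormOn b 0 1 (tailPrim G) (fun y => -G y) (fun y => -G' y)
        + freeEndForm b (∫ y in (0:ℝ)..1, G y) (-G 0) + freeEndForm b 0 (-conj (G 1))
        + π * (F0DetC (shiftGlueW b) (shiftGlue0 b) b (G 0) (∫ y in (0:ℝ)..1, G y) (conj (G 1)) 0).re := by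
  have hA2 := two_mul_re_integral_deriv_mul_conj hG
  have hC4 := two_mul_re_integral_mul_conj_primitive hG.cont
  have hW1 : (∑ j : Fin 3, shiftGlueW b j * (b j : ℂ)) = ∑ j : Fin 3, shiftW b j * (shiftN b j : ℂ) := by
    simpa [shiftRecipe] using sum_shiftGlueW_mul_b hb0
  have hW2 : (∑ j : Fin 3, shiftGlueW b j * (b j : ℂ) ^ 2)
      = ∑ j : Fin 3, shiftW b j * ((b j : ℂ) * (shiftN b j : ℂ)) := by
    simpa [shiftRecipe] using sum_shiftGlueW_mul_b_sq hb0
  rw [bulkFormOn_tailPrim_eq_re_shiftCore b hG, re_shiftCore_self, F0DetC_expand, hW1, hW2,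
    integral_mul_conj_swap_dc G G', intervalIntegral_mul_conj_self G', intervalIntegral_mul_conj_self G,
    Complex.ofReal_re, Complex.ofReal_re]
  unfold DictShift DictS SixMomentS freeEndForm atomA0 atomAb atomAN symE1 symE2 symE3
  rw [integral_mul_conj_swap_dc G G']
  simp only [shiftRecipe, Fin.sum_univ_three, shiftS, shiftN, Matrix.cons_val_zero, Matrix.cons_val_one,
    Matrix.cons_val_two, Matrix.tail_cons, Matrix.head_cons]
  set W0 : ℂ := shiftW b 0
  set W1 : ℂ := shiftW b 1
  set W2 : ℂ := shiftW b 2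
  set A1 : ℝ := ∫ x in (0:ℝ)..1, ‖G' x‖ ^ 2
  set A2 : ℂ := ∫ x in (0:ℝ)..1, G' x * conj (G x)
  set A5 : ℝ := ∫ x in (0:ℝ)..1, ‖G x‖ ^ 2
  set C4 : ℂ := ∫ x in (0:ℝ)..1, G x * conj (∫ t in (0:ℝ)..x, G t)
  set I0 : ℂ := ∫ y in (0:ℝ)..1, G y
  set a0 : ℂ := G 0
  set a1 : ℂ := G 1
  set Wp : ℂ := shiftGlueW b 0 + shiftGlueW b 1 + shiftGlueW b 2
  set cg : ℂ := shiftGlue0 b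
  simp only [norm_neg, Complex.norm_conj, norm_zero, ne_eq, OfNat.ofNat_ne_zero, not_false_eq_true, zero_pow,
    Complex.sq_norm, Complex.normSq_apply] at hA2 hC4 ⊢
  exact k1ppp_aux W0 W1 W2 Wp cg A2 C4 I0 a0 a1 (b 0) (b 1) (b 2) A1 A5 hA2 hC4

/-! ### Part 2 — assembly on the circle ℝ/2ℤ (interface form: the two-point piece displayed) -/

/-- Continuity transported along `y ↦ y + 1`. [folklore] -/
private theorem continuousOn_comp_add_one' {F : ℝ → ℂ} (hF : ContinuousOn F (Icc 0 1)) :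
    ContinuousOn (fun y => F (y + 1)) (Icc (-1) 0) := by
  refine hF.comp (continuous_id.add continuous_const).continuousOn fun y hy => ?_
  exact ⟨by linarith [hy.1], by linarith [hy.2]⟩

/-- Right-derivatives transported along `y ↦ y + 1`. [folklore] -/
private theorem hasDerivWithinAt_comp_add_one' {F F' : ℝ → ℂ}
    (hF : ∀ y ∈ Ioo (0:ℝ) 1, HasDerivWithinAt F (F' y) (Ioi y) y) {y : ℝ} (hy : y ∈ Ioo (-1:ℝ) 0) :
    HasDerivWithinAt (fun y => F (y + 1)) (F' (y + 1)) (Ioi y) y := by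
  have hy' : y + 1 ∈ Ioo (0:ℝ) 1 := ⟨by linarith [hy.1], by linarith [hy.2]⟩
  have h := hF (y + 1) hy'
  have h2 : HasDerivWithinAt (fun t : ℝ => t + 1) (1:ℝ) (Ioi y) y := (hasDerivAt_id y).add_const 1 |>.hasDerivWithinAt
  have := h.scomp y h2 (fun t ht => by simpa using ht)
  rw [Function.comp_def] at this
  simpa using this

/-- **The right arc of the circle from an ARBITRARY kinked profile**: `R = tailPrim G`, `R′ = −G`, `R″ = −G′` —
continuity on `[0,1]`, right-derivatives on `(0,1)`, `R″ ∈ L²`, and the end values `R 0 = ∫G`, `R 1 = 0` (no apex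
condition on `G`). [cite: Zhang2022LandauSiegel, Prop 7.1 p.44 with (8.11)–(8.23); §12 (12.6)–(12.8)] -/
theorem rightArc_of_kinked (hG : KinkedProfile G G') :
    ContinuousOn (tailPrim G) (Icc (0:ℝ) 1) ∧ ContinuousOn (fun y => -G y) (Icc (0:ℝ) 1)
    ∧ MemLp (fun y => -G' y) 2 (volume.restrict (Ioc (0:ℝ) 1))
    ∧ (∀ y ∈ Ioo (0:ℝ) 1, HasDerivWithinAt (tailPrim G) (-G y) (Ioi y) y)
    ∧ (∀ y ∈ Ioo (0:ℝ) 1, HasDerivWithinAt (fun y => -G y) (-G' y) (Ioi y) y)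
    ∧ tailPrim G 0 = (∫ y in (0:ℝ)..1, G y) ∧ tailPrim G 1 = 0 := by
  have hgi : IntervalIntegrable G volume 0 1 := (hG.cont.mono (by rw [uIcc_of_le zero_le_one])).intervalIntegrable
  have hrep : ∀ y ∈ Icc (0:ℝ) 1, tailPrim G y = tailPrim G 0 + ∫ t in (0:ℝ)..y, (fun t => -G t) t := by
    intro y hy
    rw [tailPrim_eq_sub hgi hy, tailPrim_zero, intervalIntegral.integral_neg]
    ring
  have hprim : ContinuousOn (fun y => tailPrim G 0 + ∫ t in (0:ℝ)..y, (fun t => -G t) t) (Icc (0:ℝ) 1) := by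
    have hint : IntervalIntegrable (fun t => -G t) volume 0 1 :=
      (hG.cont.neg.mono (by rw [uIcc_of_le zero_le_one])).intervalIntegrable
    have := intervalIntegral.continuousOn_primitive_interval' hint (by simp : (0:ℝ) ∈ uIcc (0:ℝ) 1)
    rw [uIcc_of_le zero_le_one] at this
    exact continuousOn_const.add this
  refine ⟨hprim.congr fun y hy => hrep y hy, hG.cont.neg, hG.memLp.neg,
    fun y hy => (hasDerivAt_tailPrim hG.cont hy).hasDerivWithinAt, fun y hy => (hG.hasDeriv y hy).neg,
    tailPrim_zero G, tailPrim_one G⟩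

/-- **ASSEMBLY (interface form).** For a sign-admissible `b`, a kinked profile `G` (apex free) and a two-point piece `E`
on `[0,1]` with jets `(0, −G 1)` at `0` and `(∫G, −G 0)` at `1` carrying `c₀·T(E) =` (the boundary-plus-glue block of
[K1‴]), the shift dictionary is non-negative: `0 ≤ DictShift b G G′` — the circle function is `tailPrim G` on `[0,1]`
followed by `E`, `C¹` at both junctions by construction; Parseval on ℝ/2ℤ via
`Det.bulkFormOn_periodic_two_piece_nonneg_of_signAdmissible`. [cite: Zhang2022LandauSiegel, §4 (4.1); Prop 7.1 p.44 with (7.2), (8.11)–(8.23); §18 (18.1)] -/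
theorem dictShift_nonneg_of_twoPointPiece (hb : SignAdmissible b) (hG : KinkedProfile G G')
    {E E' E'' : ℝ → ℂ} (hc : ContinuousOn E (Icc 0 1)) (hc' : ContinuousOn E' (Icc 0 1))
    (hc'' : ContinuousOn E'' (Icc 0 1))
    (hd : ∀ y ∈ Ioo (0:ℝ) 1, HasDerivWithinAt E (E' y) (Ioi y) y)
    (hd' : ∀ y ∈ Ioo (0:ℝ) 1, HasDerivWithinAt E' (E'' y) (Ioi y) y)
    (h0 : E 0 = 0) (h0' : E' 0 = -G 1) (h1 : E 1 = ∫ y in (0:ℝ)..1, G y) (h1' : E' 1 = -G 0)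
    (hid : (∑ j : Fin 3, shiftW b j).re * bulkFormOn b 0 1 E E' E''
      = freeEndForm b (∫ y in (0:ℝ)..1, G y) (-G 0) + freeEndForm b 0 (-conj (G 1))
        + π * (F0DetC (shiftGlueW b) (shiftGlue0 b) b (G 0) (∫ y in (0:ℝ)..1, G y) (conj (G 1)) 0).re) :
    0 ≤ DictShift b G G' := by
  classical
  obtain ⟨hRc, hR'c, hR''m, hRd, hR'd, hR0, hR1⟩ := rightArc_of_kinked hG
  have hb0 : ∀ j, b j ≠ 0 := fun j => (hb.pos j).ne'
  have hsum := bulkFormOn_periodic_two_piece_nonneg_of_signAdmissible hb ∅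
    (continuousOn_comp_add_one' hc) (continuousOn_comp_add_one' hc')
    (memLp_two_of_continuousOn_Icc' (continuousOn_comp_add_one' hc''))
    (fun y hy => hasDerivWithinAt_comp_add_one' hd hy) (fun y hy => hasDerivWithinAt_comp_add_one' hd' hy)
    hRc hR'c hR''m hRd (fun y hy _ => hR'd y hy)
    (by simp [h1, hR0]) (by simp [h1']) (by simp [h0, hR1]) (by simp [h0'])
  rw [bulkFormOn_comp_add_one] at hsum
  have hK := dictShift_eq_bulk_add_twoPoint hb0 hG
  have hc0 : 0 < (∑ j : Fin 3, shiftW b j).re := re_sum_shiftW_pos hb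
  have hπ : 0 < π / 2 := by positivity
  have key : π / 2 * DictShift b G G'
      = (∑ j : Fin 3, shiftW b j).re * (bulkFormOn b 0 1 E E' E''
          + bulkFormOn b 0 1 (tailPrim G) (fun y => -G y) (fun y => -G' y)) := by
    linear_combination hK - hid
  have h3 : 0 ≤ π / 2 * DictShift b G G' := by
    rw [key]; exact mul_nonneg hc0.le hsum
  by_contra hneg
  have hneg' : DictShift b G G' < 0 := lt_of_not_ge hneg
  have := mul_neg_of_pos_of_neg hπ hneg'
  linarith

/-- **ASSEMBLY, ∃-interface (the shape K2″ `Det.twoPoint_pieces` discharges):** if for the jets of `G` SOME two-point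
piece with the [K1‴] energy exists, then `0 ≤ DictShift b G G′`. [cite: Zhang2022LandauSiegel, §4 (4.1); Prop 7.1 p.44 with (7.2), (8.11)–(8.23); §18 (18.1)] -/
theorem dictShift_nonneg_of_twoPointPieces (hb : SignAdmissible b)
    (hK2 : ∀ p₁ q₁ p₂ q₂ : ℂ, ∃ E E' E'' : ℝ → ℂ,
      ContinuousOn E (Icc 0 1) ∧ ContinuousOn E' (Icc 0 1) ∧ ContinuousOn E'' (Icc 0 1) ∧
      (∀ y ∈ Ioo (0:ℝ) 1, HasDerivWithinAt E (E' y) (Ioi y) y) ∧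
      (∀ y ∈ Ioo (0:ℝ) 1, HasDerivWithinAt E' (E'' y) (Ioi y) y) ∧
      E 0 = -conj p₂ ∧ E' 0 = conj q₂ ∧ E 1 = p₁ ∧ E' 1 = q₁ ∧
      (∑ j : Fin 3, shiftW b j).re * bulkFormOn b 0 1 E E' E''
        = freeEndForm b p₁ q₁ + freeEndForm b p₂ q₂
          + π * (F0DetC (shiftGlueW b) (shiftGlue0 b) b (-q₁) p₁ (-q₂) p₂).re)
    (hG : KinkedProfile G G') : 0 ≤ DictShift b G G' := by
  obtain ⟨E, E', E'', hc, hc', hc'', hd, hd', h0, h0', h1, h1', hid⟩ :=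
    hK2 (∫ y in (0:ℝ)..1, G y) (-G 0) 0 (-conj (G 1))
  refine dictShift_nonneg_of_twoPointPiece hb hG hc hc' hc'' hd hd' (by simpa using h0) (by simpa using h0') h1 h1' ?_
  simpa using hid

end Det

end Literature.NumberTheory.LFunctions.Zhang2022
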